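import Summits.SmoothPoincare4.SmoothPoincare4.Theorems.EntropyRungChangGurskyYangStubPointPicking
import Summits.SmoothPoincare4.SmoothPoincare4.Theorems.EntropyRungChangGurskyYangStubRescaledFlow
import Summits.SmoothPoincare4.SmoothPoincare4.Theorems.EntropyRungChangGurskyYangStubRescaledNoncollapsed
import Summits.SmoothPoincare4.SmoothPoincare4.Theorems.EntropyRungChangGurskyYangOfBlowupLimit
import Literature.Geometry.Riemannian.HamiltonCompactnessRicciFlow
import Literature.Geometry.Riemannian.RicciFlowBlowupLimit
import Literature.Geometry.Riemannian.RicciFlowScaling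
import Literature.Geometry.Riemannian.MetricTraceScaling
import HarnessLib

/-!
# Route EntropyRung · crux `ChangGurskyYang` · line `margerin-cone-hamilton-rails` — Level-2:
# the blow-up limit `ricciFlow_blowupLimit_four` FROM Hamilton's compactness theorem

The named fact `Literature.Geometry.Riemannian.ricciFlow_blowupLimit_four` (Topping 2006, Thm. 8.5.1;
`RicciFlowBlowupLimit.lean`, p110613) — the one analytic leaf of STUB 4 of the skeleton
`Cruxes/ChangGurskyYang/Lines/margerin_cone_hamilton_rails.lean` (crux stmt-SmoothPoincare4-10834) — is
PROVED here from the purer named fact `Literature.Geometry.Riemannian.hamilton_compactness_ricciFlow_slice_four`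
(Hamilton 1995, Thm. 1.2, in the volume form of Morgan–Tian 2007, Thm. 5.15;
`HamiltonCompactnessRicciFlow.lean`) over three landed stubs of the line: Topping's point picking
(`stub_pointPicking`), the parabolic rescalings `Qₙ g(tₙ + s/Qₙ)` as Ricci flows on `[−Qₙtₙ, 0]` with
curvature `≤ 1` (`stub_rescaledFlow`), and their volume noncollapsing at a fixed scale from Perelman's no
local collapsing theorem (`stub_rescaledNoncollapsed`, over `perelman_noLocalCollapsing_holds`). The
assembly applies the compactness theorem to the rescaled flows (`Qₙtₙ ≥ T/2`), reindexes along the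
subsequence and undoes the scaling in the convergence clauses (`constSmul_apply`,
`scalarCurvatureWith_constSmul`, `curvNormSqWith_constSmul`, `weylNormSq_constSmul`,
`tracelessRicciNormSq_constSmul`); `|Rm_h|²(p_∞) = 1` is the limit of the constant sequence
`Qₙ⁻² Qₙ² = 1` at the base points. Corollaries: Hamilton's convergence criterion, STUB 4 and the crux
(modulo CGY Thm 1.4) from the compactness theorem alone.

No `sorry`, no definition; the only unproved input is the hypothesis
`hamilton_compactness_ricciFlow_slice_four`.
-/

noncomputable section

-- every `Summit.SmoothPoincare4.SmoothPoincare4.…` name repeats the summit = sub-problem segment (D-0017 layout)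
set_option linter.dupNamespace false

open Set Function Module Filter
open scoped Manifold ContDiff Topology ENNReal

namespace Summit.SmoothPoincare4.SmoothPoincare4.Theorems.MargerinRails

open Literature.Geometry.Riemannian
open Literature.Geometry.Lorentzian Literature.Geometry.Lorentzian.PseudoRiemannianMetric
open Summit.SmoothPoincare4.SmoothPoincare4.Theses.EntropyRung (ChangGurskyYang)

/-! ## Scaling helpers -/

/-- `|Rm|²` under homothety: `|Rm|²_{c g} = c⁻² |Rm|²_g` (same connection). [cite: Topping2006, §1.2.3] -/
theorem curvNormSqWith_constSmul {M : Type} [TopologicalSpace M]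
    [ChartedSpace (EuclideanSpace ℝ (Fin 4)) M] [IsManifold (𝓡 4) ∞ M]
    (g : PseudoRiemannianMetric (𝓡 4) ∞ (EuclideanSpace ℝ (Fin 4)) (TangentSpace (𝓡 4) : M → Type _))
    (cov : CovariantDerivative (𝓡 4) (EuclideanSpace ℝ (Fin 4)) (TangentSpace (𝓡 4) : M → Type _))
    (c : ℝ) (hc : c ≠ 0) (x : M) :
    (g.constSmul c hc).curvNormSqWith cov x = c⁻¹ ^ 2 * g.curvNormSqWith cov x := by
  have hinner : (g.constSmul c hc).curvInnerForm cov x = c⁻¹ • g.curvInnerForm cov x := by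
    ext X X'
    rw [curvInnerForm_apply, LinearMap.smul_apply, LinearMap.smul_apply, curvInnerForm_apply,
      trace_constSmul, smul_eq_mul]
  rw [curvNormSqWith, curvNormSqWith, hinner, trace_smul', trace_constSmul]
  ring

/-- `|W|²` does not depend on the Levi-Civita witness (congruence in the metric). [folklore] -/
theorem weylNormSq_congr {M : Type} [TopologicalSpace M]
    [ChartedSpace (EuclideanSpace ℝ (Fin 4)) M] [IsManifold (𝓡 4) ∞ M]
    {g₁ g₂ : PseudoRiemannianMetric (𝓡 4) ∞ (EuclideanSpace ℝ (Fin 4)) (TangentSpace (𝓡 4) : M → Type _)}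
    [g₁.HasLeviCivita] [g₂.HasLeviCivita] (h : g₁ = g₂) (x : M) :
    g₁.weylNormSq x = g₂.weylNormSq x := by
  subst h; rfl

/-- `|E|²` does not depend on the Levi-Civita witness (congruence in the metric). [folklore] -/
theorem tracelessRicciNormSq_congr {M : Type} [TopologicalSpace M]
    [ChartedSpace (EuclideanSpace ℝ (Fin 4)) M] [IsManifold (𝓡 4) ∞ M]
    {g₁ g₂ : PseudoRiemannianMetric (𝓡 4) ∞ (EuclideanSpace ℝ (Fin 4)) (TangentSpace (𝓡 4) : M → Type _)}
    [g₁.HasLeviCivita] [g₂.HasLeviCivita] (h : g₁ = g₂) (x : M) :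
    g₁.tracelessRicciNormSq x = g₂.tracelessRicciNormSq x := by
  subst h; rfl

/-! ## The blow-up limit from the compactness theorem -/

/-- **Topping 2006, Thm. 8.5.1 (the tree's named fact `ricciFlow_blowupLimit_four`) FOLLOWS from Hamilton's
compactness theorem for Ricci flows (`hamilton_compactness_ricciFlow_slice_four`)** over the tree's
maximal-existence / curvature blow-up / no-local-collapsing library: point picking (`stub_pointPicking`),
parabolic rescaling (`stub_rescaledFlow`), volume noncollapsing of the rescaled slices
(`stub_rescaledNoncollapsed`), then the compactness theorem and the unscaling of the convergence clauses.
[cite: Topping2006, §8.5, Thm. 8.5.1] [cite: Hamilton1995Compactness, Thm. 1.2] [cite: Perelman2002, §4, Thm. 4.1] -/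
theorem ricciFlow_blowupLimit_four_of_hamiltonCompactness :
    hamilton_compactness_ricciFlow_slice_four → ricciFlow_blowupLimit_four := by
  intro hF2 M _ _ _ _ _ _ _ g cov T hmax
  letI : MeasurableSpace M := borel M
  haveI : BorelSpace M := ⟨rfl⟩
  obtain ⟨p, t, Q, ht, htT, hQ1, hQ, ht2, hQp, hQmax⟩ := stub_pointPicking M g cov T hmax
  have hQpos : ∀ n, 0 < Q n := fun n ↦ one_pos.trans_le (hQ1 n)
  -- the rescaled flows
  set gr : ℕ → ℝ → PseudoRiemannianMetric (𝓡 4) ∞ (EuclideanSpace ℝ (Fin 4))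
      (TangentSpace (𝓡 4) : M → Type _) :=
    fun n s ↦ (g (t n + (Q n)⁻¹ * s)).constSmul (Q n) (one_pos.trans_le (hQ1 n)).ne' with hgr
  set covr : ℕ → ℝ → CovariantDerivative (𝓡 4) (EuclideanSpace ℝ (Fin 4))
      (TangentSpace (𝓡 4) : M → Type _) := fun n s ↦ cov (t n + (Q n)⁻¹ * s) with hcovr
  have hresc := fun n ↦ stub_rescaledFlow M g cov T hmax.isRicciFlow hmax.isRiemannian (t n) (Q n)
    (hQ1 n) (ht n) (hQmax n)
  obtain ⟨κ, r₀, hκ, hr₀, hnc⟩ :=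
    stub_rescaledNoncollapsed M g cov T hmax.pos hmax.isRicciFlow hmax.isRiemannian
  have hgr0 : ∀ n, gr n 0 = (g (t n)).constSmul (Q n) (one_pos.trans_le (hQ1 n)).ne' := by
    intro n; simp only [hgr, mul_zero, add_zero]
  have hcovr0 : ∀ n, covr n 0 = cov (t n) := by intro n; simp only [hcovr, mul_zero, add_zero]
  have hvol : ∀ k, ENNReal.ofReal (κ * r₀ ^ 4) ≤ (gr k 0).vol ((gr k 0).ball (p k) (ENNReal.ofReal r₀)) := by
    intro k
    rw [hgr0]
    exact hnc (t k) (Q k) (hQ1 k) (ht k) (ht2 k) (hQmax k) (p k)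
  have hA : ∀ k, T / 2 ≤ Q k * t k := fun k ↦
    (ht2 k).trans (le_mul_of_one_le_left (ht k).1 (hQ1 k))
  obtain ⟨sub, hsub, N, i1, i2, i3, i4, i5, i6, h, i7, hh, pinf, U, φ, hcomplete, hUo, hUm, hpU,
    hUcov, hφ, hinj, hφp, hval, hR, hRm, hW, hE⟩ :=
    hF2 M gr covr (fun n ↦ Q n * t n) p 1 (T / 2) κ r₀ (half_pos hmax.pos) hκ hr₀ hA
      (fun k ↦ (hresc k).1) (fun k ↦ (hresc k).2.1) (fun k ↦ (hresc k).2.2) hvol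
  refine ⟨p ∘ sub, t ∘ sub, Q ∘ sub, fun n ↦ ht (sub n), htT.comp hsub.tendsto_atTop,
    fun n ↦ hQpos (sub n), hQ.comp hsub.tendsto_atTop, fun n ↦ hQp (sub n),
    fun n ↦ hQmax (sub n), N, i1, i2, i3, i4, i5, i6, h, i7, hh, pinf, U, φ, hcomplete, hUo, hUm,
    hpU, hUcov, hφ, hinj, hφp, ?_, ?_, ?_, ?_, ?_, ?_⟩
  · -- normalisation `|Rm_h|²(p_∞) = 1`
    have h1 : Tendsto (fun n ↦ (gr (sub n) 0).curvNormSqWith (covr (sub n) 0) (φ n pinf)) atTop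
        (𝓝 1) := by
      refine tendsto_const_nhds.congr fun n ↦ ?_
      rw [hφp n, hgr0, hcovr0, curvNormSqWith_constSmul, hQp (sub n), inv_pow,
        inv_mul_cancel₀ (pow_ne_zero 2 (hQpos (sub n)).ne')]
    exact tendsto_nhds_unique (hRm pinf) h1
  · intro y v w
    refine (hval y v w).congr fun n ↦ ?_
    simp only [Function.comp_apply, hgr0, constSmul_apply]
  · intro y
    refine (hR y).congr fun n ↦ ?_
    simp only [Function.comp_apply, hgr0, hcovr0, scalarCurvatureWith_constSmul]
  · intro y
    refine (hRm y).congr fun n ↦ ?_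
    simp only [Function.comp_apply, hgr0, hcovr0, curvNormSqWith_constSmul]
  · intro y
    refine (hW y).congr fun n ↦ ?_
    haveI i₀ := (gr (sub n) 0).hasLeviCivita
    haveI i₁ := (g (t (sub n))).hasLeviCivita
    haveI i₂ := ((g (t (sub n))).constSmul (Q (sub n)) (one_pos.trans_le (hQ1 (sub n))).ne').hasLeviCivita
    show (gr (sub n) 0).weylNormSq (φ n y) = (Q (sub n))⁻¹ ^ 2 * (g (t (sub n))).weylNormSq (φ n y)
    rw [weylNormSq_congr (hgr0 (sub n)), weylNormSq_constSmul (g := g (t (sub n))) (hQpos (sub n))]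
  · intro y
    refine (hE y).congr fun n ↦ ?_
    haveI i₀ := (gr (sub n) 0).hasLeviCivita
    haveI i₁ := (g (t (sub n))).hasLeviCivita
    haveI i₂ := ((g (t (sub n))).constSmul (Q (sub n)) (one_pos.trans_le (hQ1 (sub n))).ne').hasLeviCivita
    show (gr (sub n) 0).tracelessRicciNormSq (φ n y) =
      (Q (sub n))⁻¹ ^ 2 * (g (t (sub n))).tracelessRicciNormSq (φ n y)
    rw [tracelessRicciNormSq_congr (hgr0 (sub n)),
      tracelessRicciNormSq_constSmul (g := g (t (sub n))) (hQpos (sub n))]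


/-! ## Corollaries: everything the line rested on `ricciFlow_blowupLimit_four` for -/

/-- Hamilton's convergence criterion (`hamilton_convergenceCriterion_four`) from the compactness theorem.
[cite: Hamilton1986, §5, 5.2 (p. 164)] [cite: Hamilton1995Compactness, Thm. 1.2] -/
theorem hamilton_convergenceCriterion_four_of_hamiltonCompactness
    (hF2 : hamilton_compactness_ricciFlow_slice_four) : hamilton_convergenceCriterion_four :=
  hamilton_convergenceCriterion_four_of_blowupLimit (ricciFlow_blowupLimit_four_of_hamiltonCompactness hF2)

/-- **The crux `EntropyRung.ChangGurskyYang` modulo {Hamilton 1995 compactness, CGY Thm. 1.4}.**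
[cite: ChangGurskyYang2003, §2, p. 121] [cite: Hamilton1995Compactness, Thm. 1.2] -/
theorem ChangGurskyYang_of_hamiltonCompactness_of_theorem14 :
    hamilton_compactness_ricciFlow_slice_four → changGurskyYang_theorem14_four → ChangGurskyYang :=
  fun hF2 ↦ ChangGurskyYang_of_blowupLimit_of_theorem14 (ricciFlow_blowupLimit_four_of_hamiltonCompactness hF2)

/-- The same for the item's second route decl `WeylBudget.ChangGurskyYang`. [cite: ChangGurskyYang2003, Thm. A] -/
theorem ChangGurskyYang_weylBudget_of_hamiltonCompactness_of_theorem14 :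
    hamilton_compactness_ricciFlow_slice_four → changGurskyYang_theorem14_four →
      Summit.SmoothPoincare4.SmoothPoincare4.Theses.WeylBudget.ChangGurskyYang :=
  ChangGurskyYang_of_hamiltonCompactness_of_theorem14

end Summit.SmoothPoincare4.SmoothPoincare4.Theorems.MargerinRails

end
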